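import Literature.Analysis.FunctionSpaces.PolchinskiCb2Calculus
import HarnessLib

/-!
# The family `s ↦ (∇√P_{0,s}F)²_{Ċ_s}` in the atoms: continuity, uniform bounds, and its uniform-in-space
# time slope (the `∂_t`-part of Bauerschmidt–Bodineau–Dagallier, Lemma 1)

Topic `Literature/Analysis/FunctionSpaces`; "proof architecture" file behind the named fact
`Polchinski.BauerschmidtBodineau_multiscaleBakryEmery` ([BBD] Theorem 3, `MultiscaleBakryEmery.lean`).
Companion of `PolchinskiExchangeJets.lean` (the spatial jets): here the TIME direction.  For families of
atoms `Z_s, W_s, Z₁ₖ,ₛ, W₁ₖ,ₛ` (in [BBD]: the Gaussian averages `E_{C_s}[e^{−V₀}(·+ζ)]`, `E_{C_s}[e^{−V₀}F(·+ζ)]`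
and their partials, proof of Prop 8 p0015) that are continuous, uniformly bounded, with `Z ≥ m > 0`,
`W ≥ aZ`, and that have uniform-in-space slopes `Ż, Ẇ, Ż₁ₖ, Ẇ₁ₖ` at `s = t` ([BBD] Prop 5, the heat equations
`∂_sE_{C_s}[G] = ½ΣĊ_s^{ij}E_{C_s}[∂_i∂_jG]`), and a matrix family `C_s` (`= Ċ_s`) differentiable at `t` with
derivative `Cd` (`= C̈_t`), the family
`G_s = (∇√u_s)²_{C_s} = Σ C_s^{kl} g_{k,s} g_{l,s} / (4u_s)`, `u_s = W_s/Z_s`, `g_{k,s} = W₁ₖ,ₛ/Z_s − W_sZ₁ₖ,ₛ/Z_s²`,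
is continuous for every `s`, bounded uniformly in `(s, y)`, and has at `s = t` the uniform-in-space slope
`Ḣ = Ȧ/(4u) − A u̇/(4u²)` with `u̇ = Ẇ/Z − WŻ/Z²`, `ġ_k`, `Ȧ = 2Σ C^{kl} ġ_k g_l + Σ Cd^{kl} g_k g_l`
(product and quotient rules, uniform version; `PolchinskiUniformSlope.lean`, `PolchinskiCb2Calculus.lean`),
and `Ḣ` is bounded and uniformly continuous.  These are exactly the hypotheses `hGc, hGb, hUG, hGdc, hGdb,
hGduc` of the dual family identity `hasDerivAt_renormExpect_family` (`PolchinskiDualGeneratorFamily.lean`).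

## Main result (sorry-free; no new definitions, no new named facts)

* **`sqrtGradient_family`** — the four conclusions above.

Pure real analysis; nothing here concerns Yang–Mills.

## References

* [BauerschmidtBodineauDagallier2023] R. Bauerschmidt, T. Bodineau, B. Dagallier, Probab. Surveys 21
  (2024) 200–290, arXiv:2307.07619 — Prop 5 p0012–p0014, Prop 8 proof p0015, Lemma 1 p0016–p0017. READ.
* [Rudin1976] W. Rudin, Principles of Mathematical Analysis — Thm 4.9, Thm 5.3.
-/

noncomputable section

open Filter Topology Set

namespace Literature.Analysis.FunctionSpaces

namespace Polchinski

variable {N : ℕ}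

/-! ### Helpers: bounded families, bounded uniformly continuous functions -/

section Helpers

variable {α : Type*}

/-- Product of bounded families is bounded. [folklore] -/
private theorem fb_mul {F G : ℝ → α → ℝ} (hF : ∃ A, ∀ s y, |F s y| ≤ A) (hG : ∃ B, ∀ s y, |G s y| ≤ B) :
    ∃ K, ∀ s y, |F s y * G s y| ≤ K := by
  obtain ⟨A, hA⟩ := hF
  obtain ⟨B, hB⟩ := hG
  refine ⟨A * B, fun s y => ?_⟩
  rw [abs_mul]
  exact mul_le_mul (hA s y) (hB s y) (abs_nonneg _) ((abs_nonneg _).trans (hA s y))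

/-- Difference of bounded families is bounded. [folklore] -/
private theorem fb_sub {F G : ℝ → α → ℝ} (hF : ∃ A, ∀ s y, |F s y| ≤ A) (hG : ∃ B, ∀ s y, |G s y| ≤ B) :
    ∃ K, ∀ s y, |F s y - G s y| ≤ K := by
  obtain ⟨A, hA⟩ := hF
  obtain ⟨B, hB⟩ := hG
  exact ⟨A + B, fun s y => (abs_sub _ _).trans (add_le_add (hA s y) (hB s y))⟩

/-- Inverse of a family bounded below by `m > 0` is bounded. [folklore] -/
private theorem fb_inv {F : ℝ → α → ℝ} {m : ℝ} (hm : 0 < m) (h : ∀ s y, m ≤ F s y) :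
    ∃ K, ∀ s y, |(F s y)⁻¹| ≤ K :=
  ⟨m⁻¹, fun s y => by
    rw [abs_inv, abs_of_pos (hm.trans_le (h s y))]
    exact inv_anti₀ hm (h s y)⟩

/-- Finite sums of bounded families are bounded. [folklore] -/
private theorem fb_sum {ι : Type*} (S : Finset ι) {F : ι → ℝ → α → ℝ}
    (h : ∀ i ∈ S, ∃ K, ∀ s y, |F i s y| ≤ K) : ∃ K, ∀ s y, |∑ i ∈ S, F i s y| ≤ K := by
  classical
  choose! K hK using h
  exact ⟨∑ i ∈ S, K i, fun s y =>
    (Finset.abs_sum_le_sum_abs _ _).trans (Finset.sum_le_sum fun i hi => hK i hi s y)⟩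

/-- Product of bounded functions is bounded. [folklore] -/
private theorem b_mul {f g : α → ℝ} (hf : ∃ A, ∀ y, |f y| ≤ A) (hg : ∃ B, ∀ y, |g y| ≤ B) :
    ∃ K, ∀ y, |f y * g y| ≤ K := by
  obtain ⟨A, hA⟩ := hf
  obtain ⟨B, hB⟩ := hg
  refine ⟨A * B, fun y => ?_⟩
  rw [abs_mul]
  exact mul_le_mul (hA y) (hB y) (abs_nonneg _) ((abs_nonneg _).trans (hA y))

/-- Sum of bounded functions is bounded. [folklore] -/
private theorem b_add {f g : α → ℝ} (hf : ∃ A, ∀ y, |f y| ≤ A) (hg : ∃ B, ∀ y, |g y| ≤ B) :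
    ∃ K, ∀ y, |f y + g y| ≤ K := by
  obtain ⟨A, hA⟩ := hf
  obtain ⟨B, hB⟩ := hg
  exact ⟨A + B, fun y => (abs_add_le _ _).trans (add_le_add (hA y) (hB y))⟩

/-- Finite sums of bounded functions are bounded. [folklore] -/
private theorem b_sum {ι : Type*} (S : Finset ι) {F : ι → α → ℝ}
    (h : ∀ i ∈ S, ∃ K, ∀ y, |F i y| ≤ K) : ∃ K, ∀ y, |∑ i ∈ S, F i y| ≤ K := by
  classical
  choose! K hK using h
  exact ⟨∑ i ∈ S, K i, fun y =>
    (Finset.abs_sum_le_sum_abs _ _).trans (Finset.sum_le_sum fun i hi => hK i hi y)⟩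

/-- Bounded uniformly continuous functions are closed under products. [cite: Rudin1976, Thm 4.9] -/
private theorem nice_mul {f g : EuclideanSpace ℝ (Fin N) → ℝ}
    (hf : UniformContinuous f ∧ ∃ A, ∀ y, |f y| ≤ A) (hg : UniformContinuous g ∧ ∃ B, ∀ y, |g y| ≤ B) :
    UniformContinuous (fun y => f y * g y) ∧ ∃ K, ∀ y, |f y * g y| ≤ K := by
  obtain ⟨A, hA⟩ := hf.2
  obtain ⟨B, hB⟩ := hg.2
  exact ⟨uc_mul hf.1 hg.1 hA hB, b_mul ⟨A, hA⟩ ⟨B, hB⟩⟩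

/-- … under sums. [cite: Rudin1976, Thm 4.9] -/
private theorem nice_add {f g : EuclideanSpace ℝ (Fin N) → ℝ}
    (hf : UniformContinuous f ∧ ∃ A, ∀ y, |f y| ≤ A) (hg : UniformContinuous g ∧ ∃ B, ∀ y, |g y| ≤ B) :
    UniformContinuous (fun y => f y + g y) ∧ ∃ K, ∀ y, |f y + g y| ≤ K :=
  ⟨hf.1.add hg.1, b_add hf.2 hg.2⟩

/-- … under differences. [cite: Rudin1976, Thm 4.9] -/
private theorem nice_sub {f g : EuclideanSpace ℝ (Fin N) → ℝ}
    (hf : UniformContinuous f ∧ ∃ A, ∀ y, |f y| ≤ A) (hg : UniformContinuous g ∧ ∃ B, ∀ y, |g y| ≤ B) :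
    UniformContinuous (fun y => f y - g y) ∧ ∃ K, ∀ y, |f y - g y| ≤ K := by
  obtain ⟨A, hA⟩ := hf.2
  obtain ⟨B, hB⟩ := hg.2
  exact ⟨hf.1.sub hg.1, A + B, fun y => (abs_sub _ _).trans (add_le_add (hA y) (hB y))⟩

/-- … under inverses of functions bounded below. [cite: Rudin1976, Thm 4.9] -/
private theorem nice_inv {f : EuclideanSpace ℝ (Fin N) → ℝ} (hf : UniformContinuous f) {m : ℝ}
    (hm : 0 < m) (hmf : ∀ y, m ≤ f y) :
    UniformContinuous (fun y => (f y)⁻¹) ∧ ∃ K, ∀ y, |(f y)⁻¹| ≤ K :=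
  ⟨uc_inv hf hm hmf, m⁻¹, fun y => by
    rw [abs_inv, abs_of_pos (hm.trans_le (hmf y))]
    exact inv_anti₀ hm (hmf y)⟩

/-- Constants. [folklore] -/
private theorem nice_const (c : ℝ) :
    UniformContinuous (fun _ : EuclideanSpace ℝ (Fin N) => c) ∧
      ∃ K, ∀ _y : EuclideanSpace ℝ (Fin N), |c| ≤ K :=
  ⟨uniformContinuous_const, |c|, fun _ => le_rfl⟩

/-- … under finite sums. [cite: Rudin1976, Thm 4.9] -/
private theorem nice_sum {ι : Type*} [DecidableEq ι] (S : Finset ι)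
    {F : ι → EuclideanSpace ℝ (Fin N) → ℝ}
    (h : ∀ i ∈ S, UniformContinuous (F i) ∧ ∃ K, ∀ y, |F i y| ≤ K) :
    UniformContinuous (fun y => ∑ i ∈ S, F i y) ∧ ∃ K, ∀ y, |∑ i ∈ S, F i y| ≤ K :=
  ⟨uc_finset_sum S F fun i hi => (h i hi).1, b_sum S fun i hi => (h i hi).2⟩

/-- Transport along a pointwise identity. [folklore] -/
private theorem nice_congr {f g : EuclideanSpace ℝ (Fin N) → ℝ}
    (hf : UniformContinuous f ∧ ∃ K, ∀ y, |f y| ≤ K) (h : ∀ y, f y = g y) :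
    UniformContinuous g ∧ ∃ K, ∀ y, |g y| ≤ K := by
  have hfg : f = g := funext h
  subst hfg
  exact hf

end Helpers

/-! ### The family `(∇√u_s)²_{C_s}` -/

section Family

/-- **The family `G_s = (∇√u_s)²_{C_s}` in the atoms: continuity, uniform bound, uniform-in-space time slope
at `s = t`, and regularity of the slope** (the `∂_t`-half of [BBD] Lemma 1 together with Prop 5; product and
quotient rules in the uniform-slope calculus).  The slope is `Ḣ = Ȧ/(4u) − A u̇/(4u²)` with
`u̇ = Ẇ/Z − WŻ/Z²`, `ġ_k = Ẇ₁ₖ/Z − W₁ₖŻ/Z² − ẆZ₁ₖ/Z² − WŻ₁ₖ/Z² + 2WZ₁ₖŻ/Z³`,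
`Ȧ = 2Σ C^{kl} ġ_k g_l + Σ Ċd^{kl} g_k g_l` (using the symmetry of `C_t`).
[cite: BauerschmidtBodineauDagallier2023, Lemma 1 (proof)] -/
theorem sqrtGradient_family
    {Zf Wf : ℝ → EuclideanSpace ℝ (Fin N) → ℝ} {Z1f W1f : Fin N → ℝ → EuclideanSpace ℝ (Fin N) → ℝ}
    {Cf : ℝ → Matrix (Fin N) (Fin N) ℝ} {Cd : Matrix (Fin N) (Fin N) ℝ}
    {t m a KW KZ1 KW1 KC KD : ℝ}
    (cZ : ∀ s, Continuous (Zf s)) (cW : ∀ s, Continuous (Wf s))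
    (cZ1 : ∀ k s, Continuous (Z1f k s)) (cW1 : ∀ k s, Continuous (W1f k s))
    (bW : ∀ s y, |Wf s y| ≤ KW) (bZ1 : ∀ k s y, |Z1f k s y| ≤ KZ1) (bW1 : ∀ k s y, |W1f k s y| ≤ KW1)
    (bC : ∀ s k l, |Cf s k l| ≤ KC)
    (hm : 0 < m) (hmZ : ∀ s y, m ≤ Zf s y) (ha : 0 < a) (haW : ∀ s y, a * Zf s y ≤ Wf s y)
    (ucZ : UniformContinuous (Zf t)) (ucW : UniformContinuous (Wf t))
    (ucZ1 : ∀ k, UniformContinuous (Z1f k t)) (ucW1 : ∀ k, UniformContinuous (W1f k t))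
    {Zd Wd : EuclideanSpace ℝ (Fin N) → ℝ} {Z1d W1d : Fin N → EuclideanSpace ℝ (Fin N) → ℝ}
    (sZ : ∀ ε : ℝ, 0 < ε → ∀ᶠ s in 𝓝 t, ∀ y, |Zf s y - Zf t y - (s - t) * Zd y| ≤ ε * |s - t|)
    (sW : ∀ ε : ℝ, 0 < ε → ∀ᶠ s in 𝓝 t, ∀ y, |Wf s y - Wf t y - (s - t) * Wd y| ≤ ε * |s - t|)
    (sZ1 : ∀ k, ∀ ε : ℝ, 0 < ε → ∀ᶠ s in 𝓝 t, ∀ y,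
      |Z1f k s y - Z1f k t y - (s - t) * Z1d k y| ≤ ε * |s - t|)
    (sW1 : ∀ k, ∀ ε : ℝ, 0 < ε → ∀ᶠ s in 𝓝 t, ∀ y,
      |W1f k s y - W1f k t y - (s - t) * W1d k y| ≤ ε * |s - t|)
    (sC : ∀ k l, HasDerivAt (fun s => Cf s k l) (Cd k l) t) (hCs : ∀ k l, Cf t l k = Cf t k l)
    (ucZd : UniformContinuous Zd) (ucWd : UniformContinuous Wd)
    (ucZ1d : ∀ k, UniformContinuous (Z1d k)) (ucW1d : ∀ k, UniformContinuous (W1d k))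
    (bZd : ∀ y, |Zd y| ≤ KD) (bWd : ∀ y, |Wd y| ≤ KD) (bZ1d : ∀ k y, |Z1d k y| ≤ KD)
    (bW1d : ∀ k y, |W1d k y| ≤ KD)
    (uf : ℝ → EuclideanSpace ℝ (Fin N) → ℝ) (huf : ∀ s y, uf s y = Wf s y * (Zf s y)⁻¹)
    (gf : Fin N → ℝ → EuclideanSpace ℝ (Fin N) → ℝ)
    (hgf : ∀ k s y, gf k s y = W1f k s y * (Zf s y)⁻¹ - Wf s y * (Z1f k s y * ((Zf s y)⁻¹ * (Zf s y)⁻¹)))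
    (Af : ℝ → EuclideanSpace ℝ (Fin N) → ℝ) (hAf : ∀ s y, Af s y = ∑ k, ∑ l, Cf s k l * (gf k s y * gf l s y))
    (Gf : ℝ → EuclideanSpace ℝ (Fin N) → ℝ) (hGf : ∀ s y, Gf s y = (1 / 4) * (Af s y * (uf s y)⁻¹))
    (ud : EuclideanSpace ℝ (Fin N) → ℝ) (hud : ∀ y, ud y = Wd y / Zf t y - Wf t y * Zd y / Zf t y ^ 2)
    (gd : Fin N → EuclideanSpace ℝ (Fin N) → ℝ)
    (hgd : ∀ k y, gd k y = W1d k y / Zf t y - W1f k t y * Zd y / Zf t y ^ 2 - Wd y * Z1f k t y / Zf t y ^ 2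
      - Wf t y * Z1d k y / Zf t y ^ 2 + 2 * Wf t y * Z1f k t y * Zd y / Zf t y ^ 3)
    (Ad : EuclideanSpace ℝ (Fin N) → ℝ)
    (hAd : ∀ y, Ad y = 2 * (∑ k, ∑ l, Cf t k l * (gd k y * gf l t y)) +
      ∑ k, ∑ l, Cd k l * (gf k t y * gf l t y))
    (Hd : EuclideanSpace ℝ (Fin N) → ℝ)
    (hHd : ∀ y, Hd y = Ad y / (4 * uf t y) - Af t y * ud y / (4 * uf t y ^ 2)) :
    (∀ s, Continuous (Gf s)) ∧ (∃ KG, ∀ s y, |Gf s y| ≤ KG) ∧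
    (∀ ε : ℝ, 0 < ε → ∀ᶠ s in 𝓝 t, ∀ y, |Gf s y - Gf t y - (s - t) * Hd y| ≤ ε * |s - t|) ∧
    Continuous Hd ∧ (∃ K, ∀ y, |Hd y| ≤ K) ∧ UniformContinuous Hd := by
  classical
  -- positivity facts
  have hZpos : ∀ s y, 0 < Zf s y := fun s y => hm.trans_le (hmZ s y)
  have hZne : ∀ s y, Zf s y ≠ 0 := fun s y => (hZpos s y).ne'
  have hau : ∀ s y, a ≤ uf s y := fun s y => by
    rw [huf, ← div_eq_mul_inv, le_div_iff₀ (hZpos s y)]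
    exact haW s y
  have hupos : ∀ s y, 0 < uf s y := fun s y => ha.trans_le (hau s y)
  have hune : ∀ s y, uf s y ≠ 0 := fun s y => (hupos s y).ne'
  have hKD : 0 ≤ KD := (abs_nonneg _).trans (bZd 0)
  ---------------------------------------------------------------- (c1) continuity
  have cIZ : ∀ s, Continuous fun y => (Zf s y)⁻¹ := fun s => (cZ s).inv₀ (hZne s)
  have cu : ∀ s, Continuous (uf s) := fun s => by
    have he : uf s = fun y => Wf s y * (Zf s y)⁻¹ := funext (huf s)
    rw [he]; exact (cW s).mul (cIZ s)
  have cg : ∀ k s, Continuous (gf k s) := fun k s => by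
    have he : gf k s = fun y => W1f k s y * (Zf s y)⁻¹ -
        Wf s y * (Z1f k s y * ((Zf s y)⁻¹ * (Zf s y)⁻¹)) := funext (hgf k s)
    rw [he]
    exact ((cW1 k s).mul (cIZ s)).sub ((cW s).mul ((cZ1 k s).mul ((cIZ s).mul (cIZ s))))
  have cA : ∀ s, Continuous (Af s) := fun s => by
    have he : Af s = fun y => ∑ k, ∑ l, Cf s k l * (gf k s y * gf l s y) := funext (hAf s)
    rw [he]
    exact continuous_finsetSum _ fun k _ => continuous_finsetSum _ fun l _ =>
      continuous_const.mul ((cg k s).mul (cg l s))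
  have cG : ∀ s, Continuous (Gf s) := fun s => by
    have he : Gf s = fun y => (1 / 4) * (Af s y * (uf s y)⁻¹) := funext (hGf s)
    rw [he]
    exact continuous_const.mul ((cA s).mul ((cu s).inv₀ (hune s)))
  ---------------------------------------------------------------- (c2) uniform bounds
  have fbIZ : ∃ K, ∀ s y, |(Zf s y)⁻¹| ≤ K := fb_inv hm hmZ
  have fbW : ∃ K, ∀ s y, |Wf s y| ≤ K := ⟨KW, bW⟩
  have fbg : ∀ k, ∃ K, ∀ s y, |gf k s y| ≤ K := fun k => by
    obtain ⟨K, hK⟩ := fb_sub (fb_mul ⟨KW1, bW1 k⟩ fbIZ)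
      (fb_mul fbW (fb_mul ⟨KZ1, bZ1 k⟩ (fb_mul fbIZ fbIZ)))
    exact ⟨K, fun s y => by rw [hgf]; exact hK s y⟩
  -- a bound for `g` uniform in `k`
  choose Kg hKg using fbg
  have hKg' : ∀ k s y, |gf k s y| ≤ ∑ j, |Kg j| := fun k s y =>
    (hKg k s y).trans ((le_abs_self _).trans
      (Finset.single_le_sum (f := fun j => |Kg j|) (fun _ _ => abs_nonneg _) (Finset.mem_univ k)))
  have fbA : ∃ K, ∀ s y, |Af s y| ≤ K := by
    obtain ⟨K, hK⟩ := fb_sum (α := EuclideanSpace ℝ (Fin N)) Finset.univ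
      (F := fun k s y => ∑ l, Cf s k l * (gf k s y * gf l s y)) fun k _ =>
        fb_sum Finset.univ (F := fun l s y => Cf s k l * (gf k s y * gf l s y)) fun l _ =>
          fb_mul (F := fun s _ => Cf s k l) ⟨KC, fun s _ => bC s k l⟩
            (fb_mul ⟨Kg k, hKg k⟩ ⟨Kg l, hKg l⟩)
    exact ⟨K, fun s y => by rw [hAf]; exact hK s y⟩
  have fbIU : ∃ K, ∀ s y, |(uf s y)⁻¹| ≤ K := fb_inv ha hau
  have fbG : ∃ K, ∀ s y, |Gf s y| ≤ K := by
    obtain ⟨K, hK⟩ := fb_mul (F := fun _ _ => (1 / 4 : ℝ)) ⟨|(1 / 4 : ℝ)|, fun _ _ => le_rfl⟩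
      (fb_mul fbA fbIU)
    exact ⟨K, fun s y => by rw [hGf]; exact hK s y⟩
  ---------------------------------------------------------------- (c4) regularity of the slope
  have nIZ : UniformContinuous (fun y => (Zf t y)⁻¹) ∧ ∃ K, ∀ y, |(Zf t y)⁻¹| ≤ K :=
    nice_inv ucZ hm (hmZ t)
  have nW : UniformContinuous (Wf t) ∧ ∃ K, ∀ y, |Wf t y| ≤ K := ⟨ucW, KW, bW t⟩
  have nZ1 : ∀ k, UniformContinuous (Z1f k t) ∧ ∃ K, ∀ y, |Z1f k t y| ≤ K :=
    fun k => ⟨ucZ1 k, KZ1, bZ1 k t⟩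
  have nW1 : ∀ k, UniformContinuous (W1f k t) ∧ ∃ K, ∀ y, |W1f k t y| ≤ K :=
    fun k => ⟨ucW1 k, KW1, bW1 k t⟩
  have nZd : UniformContinuous Zd ∧ ∃ K, ∀ y, |Zd y| ≤ K := ⟨ucZd, KD, bZd⟩
  have nWd : UniformContinuous Wd ∧ ∃ K, ∀ y, |Wd y| ≤ K := ⟨ucWd, KD, bWd⟩
  have nZ1d : ∀ k, UniformContinuous (Z1d k) ∧ ∃ K, ∀ y, |Z1d k y| ≤ K := fun k => ⟨ucZ1d k, KD, bZ1d k⟩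
  have nW1d : ∀ k, UniformContinuous (W1d k) ∧ ∃ K, ∀ y, |W1d k y| ≤ K := fun k => ⟨ucW1d k, KD, bW1d k⟩
  have nu : UniformContinuous (uf t) ∧ ∃ K, ∀ y, |uf t y| ≤ K :=
    nice_congr (nice_mul nW nIZ) fun y => (huf t y).symm
  have nIU : UniformContinuous (fun y => (uf t y)⁻¹) ∧ ∃ K, ∀ y, |(uf t y)⁻¹| ≤ K :=
    nice_inv nu.1 ha (hau t)
  have ng : ∀ k, UniformContinuous (gf k t) ∧ ∃ K, ∀ y, |gf k t y| ≤ K := fun k =>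
    nice_congr (nice_sub (nice_mul (nW1 k) nIZ) (nice_mul nW (nice_mul (nZ1 k) (nice_mul nIZ nIZ))))
      fun y => (hgf k t y).symm
  have nA : UniformContinuous (Af t) ∧ ∃ K, ∀ y, |Af t y| ≤ K :=
    nice_congr (nice_sum Finset.univ (F := fun k y => ∑ l, Cf t k l * (gf k t y * gf l t y))
      fun k _ => nice_sum Finset.univ (F := fun l y => Cf t k l * (gf k t y * gf l t y))
        fun l _ => nice_mul (nice_const _) (nice_mul (ng k) (ng l))) fun y => (hAf t y).symm
  have nud : UniformContinuous ud ∧ ∃ K, ∀ y, |ud y| ≤ K :=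
    nice_congr (nice_sub (nice_mul nWd nIZ) (nice_mul (nice_mul nW nZd) (nice_mul nIZ nIZ)))
      fun y => by
        rw [hud]
        ring
  have ngd : ∀ k, UniformContinuous (gd k) ∧ ∃ K, ∀ y, |gd k y| ≤ K := fun k =>
    nice_congr (nice_add (nice_sub (nice_sub (nice_sub (nice_mul (nW1d k) nIZ)
      (nice_mul (nice_mul (nW1 k) nZd) (nice_mul nIZ nIZ)))
      (nice_mul (nice_mul nWd (nZ1 k)) (nice_mul nIZ nIZ)))
      (nice_mul (nice_mul nW (nZ1d k)) (nice_mul nIZ nIZ)))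
      (nice_mul (nice_mul (nice_mul (nice_mul (nice_const 2) nW) (nZ1 k)) nZd)
        (nice_mul nIZ (nice_mul nIZ nIZ))))
      fun y => by
        rw [hgd]
        ring
  have nAd : UniformContinuous Ad ∧ ∃ K, ∀ y, |Ad y| ≤ K :=
    nice_congr (nice_add
      (nice_mul (nice_const 2) (nice_sum Finset.univ
        (F := fun k y => ∑ l, Cf t k l * (gd k y * gf l t y))
        fun k _ => nice_sum Finset.univ (F := fun l y => Cf t k l * (gd k y * gf l t y))
          fun l _ => nice_mul (nice_const _) (nice_mul (ngd k) (ng l))))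
      (nice_sum Finset.univ (F := fun k y => ∑ l, Cd k l * (gf k t y * gf l t y))
        fun k _ => nice_sum Finset.univ (F := fun l y => Cd k l * (gf k t y * gf l t y))
          fun l _ => nice_mul (nice_const _) (nice_mul (ng k) (ng l))))
      fun y => (hAd y).symm
  have nHd : UniformContinuous Hd ∧ ∃ K, ∀ y, |Hd y| ≤ K :=
    nice_congr (nice_sub (nice_mul (nice_mul (nice_const (1 / 4)) nAd) nIU)
      (nice_mul (nice_mul (nice_mul (nice_const (1 / 4)) nA) nud) (nice_mul nIU nIU)))
      fun y => by
        rw [hHd]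
        ring
  ---------------------------------------------------------------- (c3) the slope
  -- bounds used by the product rule
  obtain ⟨Kud, hKud⟩ := nud.2
  choose Kgd hKgd using fun k => (ngd k).2
  obtain ⟨KA, hKA⟩ := nA.2
  obtain ⟨KAd, hKAd⟩ := nAd.2
  obtain ⟨KIZ, hKIZ⟩ := fbIZ
  obtain ⟨KIU, hKIU⟩ := fbIU
  -- inverse of `Z`
  have sIZ : ∀ ε : ℝ, 0 < ε → ∀ᶠ s in 𝓝 t, ∀ y,
      |(Zf s y)⁻¹ - (Zf t y)⁻¹ - (s - t) * (-(Zd y) / (Zf t y) ^ 2)| ≤ ε * |s - t| :=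
    uniformSlope_inv sZ hm hmZ hKD bZd
  have bIZd : ∀ y, |-(Zd y) / (Zf t y) ^ 2| ≤ KD / m ^ 2 := fun y => by
    rw [abs_div, abs_neg, abs_of_pos (pow_pos (hZpos t y) 2)]
    exact div_le_div₀ hKD (bZd y) (pow_pos hm 2) (pow_le_pow_left₀ hm.le (hmZ t y) 2)
  -- `u = W · Z⁻¹`
  have su' := uniformSlope_mul sW sIZ (bW t) (B := KIZ) hKIZ bWd bIZd
  have su : ∀ ε : ℝ, 0 < ε → ∀ᶠ s in 𝓝 t, ∀ y, |uf s y - uf t y - (s - t) * ud y| ≤ ε * |s - t| := by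
    have h := uniformSlope_congr su' (fd' := ud) fun y => by
      rw [hud]
      ring
    intro ε hε
    filter_upwards [h ε hε] with s hs y
    rw [huf, huf]
    exact hs y
  -- `Z⁻²`
  have sIZ2 := uniformSlope_mul sIZ sIZ (A := KIZ) (fun y => hKIZ t y) hKIZ bIZd bIZd
  have bIZ2 : ∀ s y, |(Zf s y)⁻¹ * (Zf s y)⁻¹| ≤ KIZ * KIZ := fun s y => by
    rw [abs_mul]
    exact mul_le_mul (hKIZ s y) (hKIZ s y) (abs_nonneg _) ((abs_nonneg _).trans (hKIZ s y))
  have hKIZ0 : 0 ≤ KIZ := (abs_nonneg _).trans (hKIZ t 0)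
  have bIZ2d : ∀ y, |-(Zd y) / Zf t y ^ 2 * (Zf t y)⁻¹ + (Zf t y)⁻¹ * (-(Zd y) / Zf t y ^ 2)| ≤
      KD / m ^ 2 * KIZ + KIZ * (KD / m ^ 2) := fun y => by
    refine (abs_add_le _ _).trans (add_le_add ?_ ?_)
    · rw [abs_mul]
      exact mul_le_mul (bIZd y) (hKIZ t y) (abs_nonneg _) (by positivity)
    · rw [abs_mul]
      exact mul_le_mul (hKIZ t y) (bIZd y) (abs_nonneg _) hKIZ0
  -- `g_k`
  have sg : ∀ k, ∀ ε : ℝ, 0 < ε → ∀ᶠ s in 𝓝 t, ∀ y,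
      |gf k s y - gf k t y - (s - t) * gd k y| ≤ ε * |s - t| := by
    intro k
    -- `Z1k · Z⁻²`
    have s1 := uniformSlope_mul (sZ1 k) sIZ2 (bZ1 k t) bIZ2 (bZ1d k) bIZ2d
    have b1 : ∀ s y, |Z1f k s y * ((Zf s y)⁻¹ * (Zf s y)⁻¹)| ≤ KZ1 * (KIZ * KIZ) := fun s y => by
      rw [abs_mul]
      exact mul_le_mul (bZ1 k s y) (bIZ2 s y) (abs_nonneg _) ((abs_nonneg _).trans (bZ1 k s y))
    have b1d : ∀ y, |Z1d k y * ((Zf t y)⁻¹ * (Zf t y)⁻¹) + Z1f k t y *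
        (-(Zd y) / Zf t y ^ 2 * (Zf t y)⁻¹ + (Zf t y)⁻¹ * (-(Zd y) / Zf t y ^ 2))| ≤
        KD * (KIZ * KIZ) + KZ1 * (KD / m ^ 2 * KIZ + KIZ * (KD / m ^ 2)) := fun y => by
      refine (abs_add_le _ _).trans (add_le_add ?_ ?_)
      · rw [abs_mul]
        exact mul_le_mul (bZ1d k y) (bIZ2 t y) (abs_nonneg _) hKD
      · rw [abs_mul]
        exact mul_le_mul (bZ1 k t y) (bIZ2d y) (abs_nonneg _) ((abs_nonneg _).trans (bZ1 k t y))
    -- `W · (Z1k Z⁻²)` and `W1k · Z⁻¹`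
    have s2 := uniformSlope_mul sW s1 (bW t) b1 bWd b1d
    have s3 := uniformSlope_mul (sW1 k) sIZ (bW1 k t) hKIZ (bW1d k) bIZd
    have s4 := uniformSlope_sub s3 s2
    have h := uniformSlope_congr s4 (fd' := gd k) fun y => by
      rw [hgd]
      ring
    intro ε hε
    filter_upwards [h ε hε] with s hs y
    rw [hgf, hgf]
    exact hs y
  -- `A = Σ C g g`
  have sA' : ∀ ε : ℝ, 0 < ε → ∀ᶠ s in 𝓝 t, ∀ y,
      |(∑ k, ∑ l, Cf s k l * (gf k s y * gf l s y)) - (∑ k, ∑ l, Cf t k l * (gf k t y * gf l t y)) -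
        (s - t) * ∑ k, ∑ l, (Cd k l * (gf k t y * gf l t y) +
          Cf t k l * (gd k y * gf l t y + gf k t y * gd l y))| ≤ ε * |s - t| := by
    refine uniformSlope_sum Finset.univ fun k _ => uniformSlope_sum Finset.univ fun l _ => ?_
    have sgg := uniformSlope_mul (sg k) (sg l) (fun y => hKg' k t y) (hKg' l) (hKgd k) (hKgd l)
    have bgg : ∀ s y, |gf k s y * gf l s y| ≤ (∑ j, |Kg j|) * ∑ j, |Kg j| := fun s y => by
      rw [abs_mul]
      exact mul_le_mul (hKg' k s y) (hKg' l s y) (abs_nonneg _)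
        (Finset.sum_nonneg fun _ _ => abs_nonneg _)
    have bggd : ∀ y, |gd k y * gf l t y + gf k t y * gd l y| ≤
        Kgd k * (∑ j, |Kg j|) + (∑ j, |Kg j|) * Kgd l := fun y => by
      refine (abs_add_le _ _).trans (add_le_add ?_ ?_)
      · rw [abs_mul]
        exact mul_le_mul (hKgd k y) (hKg' l t y) (abs_nonneg _) ((abs_nonneg _).trans (hKgd k y))
      · rw [abs_mul]
        exact mul_le_mul (hKg' k t y) (hKgd l y) (abs_nonneg _)
          (Finset.sum_nonneg fun _ _ => abs_nonneg _)
    exact uniformSlope_mul (f := fun s _ => Cf s k l) (uniformSlope_of_hasDerivAt (sC k l)) sgg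
      (fun _ => bC t k l) bgg (fun _ => le_rfl) bggd
  have hAd' : ∀ y, (∑ k, ∑ l, (Cd k l * (gf k t y * gf l t y) +
      Cf t k l * (gd k y * gf l t y + gf k t y * gd l y))) = Ad y := by
    intro y
    rw [hAd]
    have hsym : ∑ k, ∑ l, Cf t k l * (gf k t y * gd l y) = ∑ k, ∑ l, Cf t k l * (gd k y * gf l t y) := by
      rw [Finset.sum_comm]
      exact Finset.sum_congr rfl fun k _ => Finset.sum_congr rfl fun l _ => by rw [hCs k l]; ring
    simp only [Finset.sum_add_distrib, mul_add]
    rw [hsym]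
    ring
  have sA : ∀ ε : ℝ, 0 < ε → ∀ᶠ s in 𝓝 t, ∀ y, |Af s y - Af t y - (s - t) * Ad y| ≤ ε * |s - t| := by
    have h := uniformSlope_congr sA' (fd' := Ad) hAd'
    intro ε hε
    filter_upwards [h ε hε] with s hs y
    rw [hAf, hAf]
    exact hs y
  -- `u⁻¹` and `H = ¼ A u⁻¹`
  have hKud0 : 0 ≤ Kud := (abs_nonneg _).trans (hKud 0)
  have sIU := uniformSlope_inv su ha hau hKud0 hKud
  have bIUd : ∀ y, |-(ud y) / (uf t y) ^ 2| ≤ Kud / a ^ 2 := fun y => by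
    rw [abs_div, abs_neg, abs_of_pos (pow_pos (hupos t y) 2)]
    exact div_le_div₀ hKud0 (hKud y) (pow_pos ha 2) (pow_le_pow_left₀ ha.le (hau t y) 2)
  have sH' := uniformSlope_const_mul (1 / 4 : ℝ)
    (uniformSlope_mul sA sIU hKA hKIU hKAd bIUd)
  have sH : ∀ ε : ℝ, 0 < ε → ∀ᶠ s in 𝓝 t, ∀ y, |Gf s y - Gf t y - (s - t) * Hd y| ≤ ε * |s - t| := by
    have h := uniformSlope_congr sH' (fd' := Hd) fun y => by
      rw [hHd]
      ring
    intro ε hε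
    filter_upwards [h ε hε] with s hs y
    rw [hGf, hGf]
    exact hs y
  exact ⟨cG, fbG, sH, nHd.1.continuous, nHd.2, nHd.1⟩

end Family

end Polchinski

end Literature.Analysis.FunctionSpaces

end
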